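import Literature.AnabelianGeometry.EtaleTheta.Discharge.Sec5Prop52iSecondAlternative
import Literature.AnabelianGeometry.EtaleTheta.Discharge.Sec5Prop52iFromLawsOfConnectedTemperoid
import Literature.AnabelianGeometry.EtaleTheta.Discharge.Sec5OfThetaSetting
import HarnessLib.Audit.LibrarySuggestionsDenyListEtaleTheta

/-!
# [EtTh] Prop. 5.2 (i) p.324 (PDF p.98) at the §5 data OF THE §1 SETTING (`ofThetaSettingData`, `A_⊙^bs := Ÿ̲̲`): both printed alternatives, the residual isolated, and the law-built root family at every level

Mochizuki, *The étale theta function and its Frobenioid-theoretic manifestations*, Publ. RIMS **45** (2009), Prop. 5.2 (i)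
p.324 (PDF p.98; kurims ms p.89): «The pair of morphisms of `C` determined by "`s_{l·N}`", "`τ_{l·N}`" constitutes an `l·N`-th root of
a right fraction-pair [cf. Proposition 4.2, (iii)] of [the Frobenioid-theoretic version of the log-meromorphic function constituted by]
the theta function `Θ̈` of Proposition 1.4, or, alternatively, an `N`-th root of a right fraction-pair [cf. Proposition 4.2, (iii)] of
[…] an `l`-th root of the theta function `Θ̈` [cf. Remark 4.3.2]»; printed proof (p.324): «These assertions follow immediately from the
definitions. In the case of assertion (i), we observe that the "`(l·N, H_⊙, f|_{A_{l·N}})`-saturated-ness" condition of Proposition 4.2,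
(iii), follows immediately from the definition of the field `J̈_{l·N}` in §1.»
[cite: MochizukiEtTh2009, Prop 5.2 (i) p.324 (PDF p.98); Rmk 4.3.2 p.318–319 (PDF pp.92–93); §5 p.322 (PDF p.96)]

abc-iut cell, layer L2, seat abc-iut-L2-t11 (gen 8; WAVE2-SLICES row W2-L2-07 «routine clauses of Prop 5.2 (i)–(iii)»), cone node `EtTh:Prop5.2(i)`.
PROOF-ONLY companion (0 `def`, no named fact, no instance; nothing landed is edited or restated — every input is consumed BY NAME).  The rows
F-0555/F-0556/F-0558 (Prop. 5.2 (ii)/(iii) + `StrvSection`) were read at the §5 data of the Setting by abc-iut-f-126 (`Sec5Prop52AtThetaSetting`,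
p442563); Prop. 5.2 (i) — not a FACT row — had so far NO theorem at `ThetaFrobenioid.ofThetaSettingData` (abc-iut-L2-t4, `Sec5OfThetaSetting`: the
§5 data over `B^temp(Π^tp_X̲̲)⁰` with `(X, T, ιX) := (Π^tp_X̲̲ = C.Huu, C.thetaEnvData μ hC hS, id)`), only at the generic `ofConnectedTemperoidData`.
Since `ofThetaSettingData` IS `ofConnectedTemperoidData` there (`ofThetaSettingData_eq`, `rfl`), every proof below is a citation:

* §1 any Frobenius-trivial Galois `A_⊙`, any rendering `pullFrac` of the pull-back of birational units:
  `thetaPairIsRoot_second_ofThetaSettingData` (SECOND alternative, modulo the identity law `hpull_id` only; abc-iut-w6-d085's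
  `thetaPairIsRoot_second_ofConnectedTemperoidData`), `thetaPairIsRoot_ofThetaSettingData_iff` (the typed node ⟺ its FIRST alternative
  `hcomp : PairIsNthRootOf pullFrac (l·N) Θ̈ s^⊓_N s^⊔_N`, GAP G-L2t4-1), `thetaPairIsRoot_ofThetaSettingData` (the node modulo the Rmk. 4.3.2
  closure data (C1) `Dc`, (C1′) `hD`, (C2) `hsat`, (C3) `hpow` of abc-iut-w5-d234's `NthRoot.hcomp_of`; abc-iut-L2-t4's
  `thetaPairIsRoot_ofConnectedTemperoidData`, p428278).
* §2 `pullFrac :=` abc-iut-L2-t9's model pull-back `pullFracModel = ((α')^birat)^*` on the nose: `thetaPairIsRoot_second_ofThetaSettingData_model`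
  (SECOND alternative, UNCONDITIONAL), `thetaPairIsRoot_ofThetaSettingData_iff_model`, and **`thetaPairIsRoot_ofThetaSettingData_of_comp`** —
  Prop. 5.2 (i) (BOTH alternatives) at the §5 data of the Setting modulo EXACTLY the three clauses on the `N`-domain `A_N` of
  abc-iut-w5-d134's composite root (`BiKummerSetting.pairIsNthRootOf_comp_mkOfModelCanonical`, p427648, via abc-iut-L2-t4's
  `thetaPairIsRoot_ofConnectedTemperoidData_of_comp`): `hsk` (`A_N` in a skeleton through `A_⊙`), `hμ` (`A_N` is `μ_{l·N}`-saturated,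
  Def. 4.1 (iv)(a)), `hcondA` (Def. 4.1 (iii)(a) at level `l·N` — print's «definition of the field `J̈_{l·N}`»).
* §3 the LAW-BUILT root family of abc-iut-w6-d053 (`exists_rootFamily_thetaPairIsRoot_ofConnectedTemperoid(_of_baseRootLaw)`, p446735) read at
  the Setting: **`exists_rootFamily_thetaPairIsRoot_ofThetaSetting`** — from the [FrdI] Thm. 5.2 hypotheses `h`, the base-level laws
  `hDSpull`, `hEdiv`, the E2 root law `hR` (for abc-iut-L2-t3's `TemperedFrobenioid.BaseRootLaw` + `hTF` feed `hR :=
  tf.rootLaw_of_baseRootLaw' …` exactly as in abc-iut-w6-d053's `_of_baseRootLaw`) and ONE `l`-th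
  root datum `Rl` of `Θ̈`'s fraction-pair (`hskl`, `hfixl`): a family `R N` such that at EVERY level `N`, for EVERY mod-`N` cyclotome datum
  `μ : D.CyclotomeMod l N` of the Setting and all constants / divisor invariances, Prop. 5.2 (i) holds for `ofThetaSettingData μ hC hS h Q (R N) …`
  with NO `N`-domain binder.
* §4 `A_⊙^bs := Ÿ̲̲` (`BiKummerSetting.mkOfThetaSettingYdd`, p.322; the Ÿ̲̲-junction data of record of the L2 §5 lane): `…YddData_model` /
  `…YddData_iff_model` (UNCONDITIONAL / residual isolation), **`thetaPairIsRoot_ofThetaSettingYddData_of_comp`** (modulo {`hsk`, `hμ`, `hcondA`}).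

RESIDUAL OF THE NODE AT THE SETTING (census form): Prop. 5.2 (i) ⟺ its first alternative ⟸ EXACTLY {`hsk`, `hμ`, `hcondA`} on the given
`N`-domain (§2/§4), or NO `N`-domain binder for the law-built family ⟸ {`hDSpull`, `hEdiv`, E2 root law, `Rl` with `hskl`/`hfixl`} (§3); data `tf`
(Ex. 3.9 DATA over `B^temp(Π^tp_X̲̲)⁰`), `h`, `Q`, `K'`/`constEmb`, `hinvc`/`hinvp`; Setting side `e`, `μ`, `hC`, `hS`.  HONEST FRAMING: kernel-checked
consequences for data so typed; `tf` is NOT shown inhabited for the curve; nothing of [EtTh] (a refereed paper) is asserted unconditionally;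
typed ≠ proved; nothing here bears on [IUTchIII] Cor. 3.12 and no side is taken.
-/

noncomputable section

namespace Literature.AnabelianGeometry.EtaleTheta

open CategoryTheory Opposite Literature.AlgebraicGeometry.Frobenioids Literature.AnabelianGeometry.SemiGraphs
  Literature.AnabelianGeometry.SemiGraphs.GaloisObjects Literature.AlgebraicGeometry.Frobenioids.QuasiTemperoid.BTempConnected

universe v₀

namespace ThetaFrobenioid

/-! ### §1 At `ofThetaSettingData` (any Frobenius-trivial Galois `A_⊙`, any pull-back rendering `pullFrac`) -/

section OfThetaSettingData

variable {p : ℕ} [Fact p.Prime] {D : ThetaSetting p} {E : D.EtaleThetaData} {l : ℕ} {C : E.DoubleUnderline l}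
  {e : D.toTemperedCurve.GroupLevelData} {N : ℕ+} (μ : D.CyclotomeMod l N) (hC : D.Compat) (hS : D.Sec2Hyps)
  {D₀ : Type} [Category.{v₀} D₀] {V : FrdIMonoidStub.{0}} {T₀ : RealifiedDivisorMonoids (D₀ := D₀) V}
  {VD : FrdICatStub.{1, 0, 0} (ConnectedPart (BTemp (C.temperedArithmeticGroup e).Pi))}
  {tf : TemperedFrobenioid T₀ (ConnectedPart (BTemp (C.temperedArithmeticGroup e).Pi)) VD} {hZ : tf.monoidType = MonoidType.Z}
  {hP : ∀ A : (ConnectedPart (BTemp (C.temperedArithmeticGroup e).Pi))ᵒᵖ, IsPerfect (tf.Φ.carrier A)}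
  {NH : Subgroup (Field.absoluteGaloisGroup D.K) → tf.category → ℕ+ → Prop} {A₀ : tf.category}
  {hA₀ : PreFrobenioid.IsFrobeniusTrivial tf.toElem A₀} {hA₀' : SemiGraphs.IsGaloisObj A₀.base.obj}
  {pullFrac : ∀ {A A' : (BiKummerSetting.mkOfConnectedTemperoid (C.temperedArithmeticGroup e) tf hZ hP NH A₀ hA₀ hA₀').C} (_ : A' ⟶ A),
    (BiKummerSetting.mkOfConnectedTemperoid (C.temperedArithmeticGroup e) tf hZ hP NH A₀ hA₀ hA₀').biratUnits A →
      (BiKummerSetting.mkOfConnectedTemperoid (C.temperedArithmeticGroup e) tf hZ hP NH A₀ hA₀ hA₀').biratUnits A'}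
  {θ : (BiKummerSetting.mkOfConnectedTemperoid (C.temperedArithmeticGroup e) tf hZ hP NH A₀ hA₀ hA₀').biratUnits
    (BiKummerSetting.mkOfConnectedTemperoid (C.temperedArithmeticGroup e) tf hZ hP NH A₀ hA₀ hA₀').Aodot}
  {Bl : (BiKummerSetting.mkOfConnectedTemperoid (C.temperedArithmeticGroup e) tf hZ hP NH A₀ hA₀ hA₀').C}
  {Pl : (BiKummerSetting.mkOfConnectedTemperoid (C.temperedArithmeticGroup e) tf hZ hP NH A₀ hA₀ hA₀').FractionPair θ Bl}
  {Rl : (BiKummerSetting.mkOfConnectedTemperoid (C.temperedArithmeticGroup e) tf hZ hP NH A₀ hA₀ hA₀').NthRoot θ Pl C.lPNat pullFrac}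
  (h : ModelFrobenioid.Hypotheses tf.divisorMonoid tf.ratFnFunctor)
  (Q : FrobenioidTheta.ThetaSubquotientStub.{0} (ConnectedPart (BTemp (C.temperedArithmeticGroup e).Pi)))
  (R : (BiKummerSetting.mkOfConnectedTemperoid (C.temperedArithmeticGroup e) tf hZ hP NH A₀ hA₀ hA₀').NthRoot Rl.root Rl.pair N pullFrac)
  (K' : Type) [Field K'] (constEmb : K'ˣ →* tf.biratUnitsModel R.BN) (constEmb_injective : Function.Injective constEmb)
  (hinvc : ∀ g : Aut R.AN.base,
    pull tf.divisorMonoid g.hom (ModelFrobenioid.div R.pair.num) = ModelFrobenioid.div R.pair.num)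
  (hinvp : ∀ y : (C.thetaEnvData μ hC hS).PiX, y ∈ (C.thetaEnvData μ hC hS).PiYdd →
    pull tf.divisorMonoid ((BiKummerSetting.mkOfConnectedTemperoid (C.temperedArithmeticGroup e) tf hZ hP NH A₀ hA₀ hA₀').galoisSurj
      R.AN.base R.αData.isGalois ((ContinuousMulEquiv.refl _) y)).hom (ModelFrobenioid.div R.pair.den) = ModelFrobenioid.div R.pair.den)

/-- **[EtTh] Prop. 5.2 (i), SECOND alternative, at the §5 data of the Setting** — «an `N`-th root of a right fraction-pair of an `l`-th root
of the theta function `Θ̈`» — in the real §4 vocabulary `BiKummerVocabStub.ofBiKummerSetting` (dictionary = identity), modulo only the identity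
law of the rendering `pullFrac` (abc-iut-w6-d085's `thetaPairIsRoot_second_ofConnectedTemperoidData`).  [cite: MochizukiEtTh2009, Prop 5.2 (i) p.324 (PDF p.98)] -/
theorem thetaPairIsRoot_second_ofThetaSettingData
    (hpull_id : ∀ (A : (BiKummerSetting.mkOfConnectedTemperoid (C.temperedArithmeticGroup e) tf hZ hP NH A₀ hA₀ hA₀').C)
      (x : (BiKummerSetting.mkOfConnectedTemperoid (C.temperedArithmeticGroup e) tf hZ hP NH A₀ hA₀ hA₀').biratUnits A),
      pullFrac (𝟙 A) x = x) :
    ∃ (A' : (BiKummerSetting.mkOfConnectedTemperoid (C.temperedArithmeticGroup e) tf hZ hP NH A₀ hA₀ hA₀').C)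
      (g : (ofThetaSettingData μ hC hS h Q R K' constEmb constEmb_injective hinvc hinvp).biratUnits A'),
      (FrobenioidThetaBiKummer.BiKummerVocabStub.ofBiKummerSetting
          (BiKummerSetting.mkOfConnectedTemperoid (C.temperedArithmeticGroup e) tf hZ hP NH A₀ hA₀ hA₀') pullFrac
          (ofThetaSettingData μ hC hS h Q R K' constEmb constEmb_injective hinvc hinvp)
          fun _ => (MulEquiv.ofBijective (MonoidHom.id _) Function.bijective_id).symm).IsRootOf
        (ofThetaSettingData μ hC hS h Q R K' constEmb constEmb_injective hinvc hinvp).l g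
        (ofThetaSettingData μ hC hS h Q R K' constEmb constEmb_injective hinvc hinvp).thetaFn ∧
      (FrobenioidThetaBiKummer.BiKummerVocabStub.ofBiKummerSetting
          (BiKummerSetting.mkOfConnectedTemperoid (C.temperedArithmeticGroup e) tf hZ hP NH A₀ hA₀ hA₀') pullFrac
          (ofThetaSettingData μ hC hS h Q R K' constEmb constEmb_injective hinvc hinvp)
          fun _ => (MulEquiv.ofBijective (MonoidHom.id _) Function.bijective_id).symm).IsRootOfRightFractionPair
        (ofThetaSettingData μ hC hS h Q R K' constEmb constEmb_injective hinvc hinvp).N g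
        (ofThetaSettingData μ hC hS h Q R K' constEmb constEmb_injective hinvc hinvp).sCap
        (ofThetaSettingData μ hC hS h Q R K' constEmb constEmb_injective hinvc hinvp).sCup :=
  thetaPairIsRoot_second_ofConnectedTemperoidData (T := C.thetaEnvData μ hC hS) h Q C.odd_lPNat R (ContinuousMulEquiv.refl _) K'
    constEmb constEmb_injective hinvc hinvp hpull_id

/-- **Residual isolation for `EtTh:Prop5.2(i)` at the §5 data of the Setting**: the typed Prop. 5.2 (i) (conjunction of both printed
alternatives) is EQUIVALENT to its first alternative alone — `(s^⊓_N, s^⊔_N)` is an `l·N`-th root of a right fraction-pair of `Θ̈` (GAP G-L2t4-1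
= G-L2t4-1a/1b) — modulo the identity law of `pullFrac`.  [cite: MochizukiEtTh2009, Prop 5.2 (i) p.324 (PDF p.98); Rmk 4.3.2 p.318 (PDF p.92)] -/
theorem thetaPairIsRoot_ofThetaSettingData_iff
    (hpull_id : ∀ (A : (BiKummerSetting.mkOfConnectedTemperoid (C.temperedArithmeticGroup e) tf hZ hP NH A₀ hA₀ hA₀').C)
      (x : (BiKummerSetting.mkOfConnectedTemperoid (C.temperedArithmeticGroup e) tf hZ hP NH A₀ hA₀ hA₀').biratUnits A),
      pullFrac (𝟙 A) x = x) :
    FrobenioidThetaBiKummer.ThetaPairIsRoot (ofThetaSettingData μ hC hS h Q R K' constEmb constEmb_injective hinvc hinvp)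
        (FrobenioidThetaBiKummer.BiKummerVocabStub.ofBiKummerSetting
          (BiKummerSetting.mkOfConnectedTemperoid (C.temperedArithmeticGroup e) tf hZ hP NH A₀ hA₀ hA₀') pullFrac _
          fun _ => (MulEquiv.ofBijective (MonoidHom.id _) Function.bijective_id).symm) ↔
      (BiKummerSetting.mkOfConnectedTemperoid (C.temperedArithmeticGroup e) tf hZ hP NH A₀ hA₀ hA₀').PairIsNthRootOf pullFrac
        ((C.lPNat : ℕ) * N) θ R.pair.num R.pair.den :=
  thetaPairIsRoot_ofConnectedTemperoidData_iff (T := C.thetaEnvData μ hC hS) h Q C.odd_lPNat R (ContinuousMulEquiv.refl _) K'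
    constEmb constEmb_injective hinvc hinvp hpull_id

/-- **[EtTh] Prop. 5.2 (i) (both alternatives) at the §5 data of the Setting, modulo the Rmk. 4.3.2 closure data** (C1) a base-Frobenius datum
`Dc` of the composite `α_N ≫ α_l`, (C1′) its pull-back compatibility `hD`, (C2) the `(l·N, H_⊙)`-saturation `hsat`, (C3) `hpow`, and the identity
law `hpull_id` (abc-iut-L2-t4's `thetaPairIsRoot_ofConnectedTemperoidData`, p428278).  [cite: MochizukiEtTh2009, Prop 5.2 (i) p.324 (PDF p.98)] -/
theorem thetaPairIsRoot_ofThetaSettingData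
    (Dc : (BiKummerSetting.mkOfConnectedTemperoid (C.temperedArithmeticGroup e) tf hZ hP NH A₀ hA₀ hA₀').BaseFrobeniusTypeData (R.α ≫ Rl.α))
    (hD : pullFrac Dc.α₁ θ = pullFrac R.αData.α₁ (pullFrac Rl.αData.α₁ θ))
    (hsat : (BiKummerSetting.mkOfConnectedTemperoid (C.temperedArithmeticGroup e) tf hZ hP NH A₀ hA₀ hA₀').IsSaturated R.AN (C.lPNat * N)
      (pullFrac Dc.α₁ θ))
    (hpull_id : ∀ (A : (BiKummerSetting.mkOfConnectedTemperoid (C.temperedArithmeticGroup e) tf hZ hP NH A₀ hA₀ hA₀').C)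
      (x : (BiKummerSetting.mkOfConnectedTemperoid (C.temperedArithmeticGroup e) tf hZ hP NH A₀ hA₀ hA₀').biratUnits A),
      pullFrac (𝟙 A) x = x)
    (hpow : ∀ (x : (BiKummerSetting.mkOfConnectedTemperoid (C.temperedArithmeticGroup e) tf hZ hP NH A₀ hA₀ hA₀').biratUnits Rl.AN) (n : ℕ),
      pullFrac R.αData.α₁ (x ^ n) = pullFrac R.αData.α₁ x ^ n) :
    FrobenioidThetaBiKummer.ThetaPairIsRoot (ofThetaSettingData μ hC hS h Q R K' constEmb constEmb_injective hinvc hinvp)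
      (FrobenioidThetaBiKummer.BiKummerVocabStub.ofBiKummerSetting
        (BiKummerSetting.mkOfConnectedTemperoid (C.temperedArithmeticGroup e) tf hZ hP NH A₀ hA₀ hA₀') pullFrac _
        fun _ => (MulEquiv.ofBijective (MonoidHom.id _) Function.bijective_id).symm) :=
  thetaPairIsRoot_ofConnectedTemperoidData (T := C.thetaEnvData μ hC hS) h Q C.odd_lPNat R (ContinuousMulEquiv.refl _) K' constEmb
    constEmb_injective hinvc hinvp Dc hD hsat hpull_id hpow

end OfThetaSettingData

/-! ### §2 At `ofThetaSettingData` with `pullFrac := pullFracModel` on the nose: the node modulo {`hsk`, `hμ`, `hcondA`} -/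

section Model

variable {p : ℕ} [Fact p.Prime] {D : ThetaSetting p} {E : D.EtaleThetaData} {l : ℕ} {C : E.DoubleUnderline l}
  {e : D.toTemperedCurve.GroupLevelData} {N : ℕ+} (μ : D.CyclotomeMod l N) (hC : D.Compat) (hS : D.Sec2Hyps)
  {D₀ : Type} [Category.{v₀} D₀] {V : FrdIMonoidStub.{0}} {T₀ : RealifiedDivisorMonoids (D₀ := D₀) V}
  {VD : FrdICatStub.{1, 0, 0} (ConnectedPart (BTemp (C.temperedArithmeticGroup e).Pi))}
  {tf : TemperedFrobenioid T₀ (ConnectedPart (BTemp (C.temperedArithmeticGroup e).Pi)) VD} {hZ : tf.monoidType = MonoidType.Z}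
  {hP : ∀ A : (ConnectedPart (BTemp (C.temperedArithmeticGroup e).Pi))ᵒᵖ, IsPerfect (tf.Φ.carrier A)}
  {NH : Subgroup (Field.absoluteGaloisGroup D.K) → tf.category → ℕ+ → Prop} {A₀ : tf.category}
  {hA₀ : PreFrobenioid.IsFrobeniusTrivial tf.toElem A₀} {hA₀' : SemiGraphs.IsGaloisObj A₀.base.obj}
  {θ : tf.biratUnitsModel A₀} {Bl : tf.category}
  {Pl : (BiKummerSetting.mkOfConnectedTemperoid (C.temperedArithmeticGroup e) tf hZ hP NH A₀ hA₀ hA₀').FractionPair θ Bl}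
  {Rl : (BiKummerSetting.mkOfConnectedTemperoid (C.temperedArithmeticGroup e) tf hZ hP NH A₀ hA₀ hA₀').NthRoot θ Pl C.lPNat
    (fun {_} φ x => tf.pullFracModel φ x)}
  (h : ModelFrobenioid.Hypotheses tf.divisorMonoid tf.ratFnFunctor)
  (Q : FrobenioidTheta.ThetaSubquotientStub.{0} (ConnectedPart (BTemp (C.temperedArithmeticGroup e).Pi)))
  (R : (BiKummerSetting.mkOfConnectedTemperoid (C.temperedArithmeticGroup e) tf hZ hP NH A₀ hA₀ hA₀').NthRoot Rl.root Rl.pair N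
    (fun {_} φ x => tf.pullFracModel φ x))
  (K' : Type) [Field K'] (constEmb : K'ˣ →* tf.biratUnitsModel R.BN) (constEmb_injective : Function.Injective constEmb)
  (hinvc : ∀ g : Aut R.AN.base,
    pull tf.divisorMonoid g.hom (ModelFrobenioid.div R.pair.num) = ModelFrobenioid.div R.pair.num)
  (hinvp : ∀ y : (C.thetaEnvData μ hC hS).PiX, y ∈ (C.thetaEnvData μ hC hS).PiYdd →
    pull tf.divisorMonoid ((BiKummerSetting.mkOfConnectedTemperoid (C.temperedArithmeticGroup e) tf hZ hP NH A₀ hA₀ hA₀').galoisSurj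
      R.AN.base R.αData.isGalois ((ContinuousMulEquiv.refl _) y)).hom (ModelFrobenioid.div R.pair.den) = ModelFrobenioid.div R.pair.den)

/-- **[EtTh] Prop. 5.2 (i) — BOTH printed alternatives — at the §5 data OF THE §1 SETTING with the model pull-back**, modulo EXACTLY the
three clauses on the `N`-domain `A_N` of abc-iut-w5-d134's composite root (`pairIsNthRootOf_comp_mkOfModelCanonical`, p427648): `hsk` (`A_N`
lies in a skeleton through `A_⊙`), `hμ` (`A_N` is `μ_{l·N}`-saturated, Def. 4.1 (iv)(a)) and `hcondA` (Def. 4.1 (iii)(a) at level `l·N` — print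
p.324: «follows immediately from the definition of the field `J̈_{l·N}` in §1»); abc-iut-L2-t4's `thetaPairIsRoot_ofConnectedTemperoidData_of_comp`
read at `(Π^tp_X̲̲, C.thetaEnvData μ hC hS, id)`.  [cite: MochizukiEtTh2009, Prop 5.2 (i) p.324 (PDF p.98); Def 4.1 (iii)(iv) p.312–313 (PDF pp.86–87)] -/
theorem thetaPairIsRoot_ofThetaSettingData_of_comp
    (hsk : Nonempty (R.AN.base ≅ A₀.base) → R.AN = A₀) (hμ : tf.IsMuSaturated R.AN (C.lPNat * N))
    (hcondA : ∃ (A' A'' : tf.category) (s₁ : A' ⟶ R.AN) (s₂ : A' ⟶ A''),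
      (BiKummerSetting.mkOfConnectedTemperoid (C.temperedArithmeticGroup e) tf hZ hP NH A₀ hA₀ hA₀').IsPreStep s₁ ∧
        (BiKummerSetting.mkOfConnectedTemperoid (C.temperedArithmeticGroup e) tf hZ hP NH A₀ hA₀ hA₀').IsPreStep s₂ ∧
          (BiKummerSetting.mkOfConnectedTemperoid (C.temperedArithmeticGroup e) tf hZ hP NH A₀ hA₀ hA₀').IsFrobeniusTrivial A'' ∧
            (BiKummerSetting.mkOfConnectedTemperoid (C.temperedArithmeticGroup e) tf hZ hP NH A₀ hA₀ hA₀').IsNHSaturatedBsFld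
              (BiKummerSetting.mkOfConnectedTemperoid (C.temperedArithmeticGroup e) tf hZ hP NH A₀ hA₀ hA₀').HodotBsFld A'' (C.lPNat * N)) :
    FrobenioidThetaBiKummer.ThetaPairIsRoot
      (ofThetaSettingData (pullFrac := fun {_ _} φ x => tf.pullFracModel φ x) μ hC hS h Q R K' constEmb constEmb_injective hinvc hinvp)
      (FrobenioidThetaBiKummer.BiKummerVocabStub.ofBiKummerSetting
        (BiKummerSetting.mkOfConnectedTemperoid (C.temperedArithmeticGroup e) tf hZ hP NH A₀ hA₀ hA₀') (fun {_ _} φ x => tf.pullFracModel φ x) _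
        fun _ => (MulEquiv.ofBijective (MonoidHom.id _) Function.bijective_id).symm) :=
  thetaPairIsRoot_ofConnectedTemperoidData_of_comp (T := C.thetaEnvData μ hC hS) h Q C.odd_lPNat R (ContinuousMulEquiv.refl _) K'
    constEmb constEmb_injective hinvc hinvp hsk hμ hcondA

/-- **SECOND alternative at the §5 data of the Setting with the model pull-back — UNCONDITIONAL** («an `N`-th root of a right fraction-pair of
an `l`-th root of `Θ̈`»: the witness is the given `l`-th root `Rl.root`).  [cite: MochizukiEtTh2009, Prop 5.2 (i) p.324 (PDF p.98)] -/
theorem thetaPairIsRoot_second_ofThetaSettingData_model :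
    ∃ (A' : (BiKummerSetting.mkOfConnectedTemperoid (C.temperedArithmeticGroup e) tf hZ hP NH A₀ hA₀ hA₀').C)
      (g : (ofThetaSettingData (pullFrac := fun {_ _} φ x => tf.pullFracModel φ x) μ hC hS h Q R K' constEmb constEmb_injective hinvc
        hinvp).biratUnits A'),
      (FrobenioidThetaBiKummer.BiKummerVocabStub.ofBiKummerSetting
          (BiKummerSetting.mkOfConnectedTemperoid (C.temperedArithmeticGroup e) tf hZ hP NH A₀ hA₀ hA₀') (fun {_ _} φ x => tf.pullFracModel φ x)
          (ofThetaSettingData (pullFrac := fun {_ _} φ x => tf.pullFracModel φ x) μ hC hS h Q R K' constEmb constEmb_injective hinvc hinvp)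
          fun _ => (MulEquiv.ofBijective (MonoidHom.id _) Function.bijective_id).symm).IsRootOf
        (ofThetaSettingData (pullFrac := fun {_ _} φ x => tf.pullFracModel φ x) μ hC hS h Q R K' constEmb constEmb_injective hinvc hinvp).l g
        (ofThetaSettingData (pullFrac := fun {_ _} φ x => tf.pullFracModel φ x) μ hC hS h Q R K' constEmb constEmb_injective hinvc
          hinvp).thetaFn ∧
      (FrobenioidThetaBiKummer.BiKummerVocabStub.ofBiKummerSetting
          (BiKummerSetting.mkOfConnectedTemperoid (C.temperedArithmeticGroup e) tf hZ hP NH A₀ hA₀ hA₀') (fun {_ _} φ x => tf.pullFracModel φ x)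
          (ofThetaSettingData (pullFrac := fun {_ _} φ x => tf.pullFracModel φ x) μ hC hS h Q R K' constEmb constEmb_injective hinvc hinvp)
          fun _ => (MulEquiv.ofBijective (MonoidHom.id _) Function.bijective_id).symm).IsRootOfRightFractionPair
        (ofThetaSettingData (pullFrac := fun {_ _} φ x => tf.pullFracModel φ x) μ hC hS h Q R K' constEmb constEmb_injective hinvc hinvp).N g
        (ofThetaSettingData (pullFrac := fun {_ _} φ x => tf.pullFracModel φ x) μ hC hS h Q R K' constEmb constEmb_injective hinvc hinvp).sCap
        (ofThetaSettingData (pullFrac := fun {_ _} φ x => tf.pullFracModel φ x) μ hC hS h Q R K' constEmb constEmb_injective hinvc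
          hinvp).sCup :=
  thetaPairIsRoot_second_ofConnectedTemperoidData (pullFrac := fun {_ _} φ x => tf.pullFracModel φ x)
    (T := C.thetaEnvData μ hC hS) h Q C.odd_lPNat R (ContinuousMulEquiv.refl _) K' constEmb constEmb_injective hinvc hinvp
    fun A x => tf.pullFracModel_id A x

/-- **Residual isolation at the Setting with the model pull-back, outright**: the typed Prop. 5.2 (i) ⟺ its first alternative; with
`thetaPairIsRoot_ofThetaSettingData_of_comp` the node's open content AT THE SETTING is exactly {`hsk`, `hμ`, `hcondA`}.  [cite: MochizukiEtTh2009, Prop 5.2 (i) p.324 (PDF p.98)] -/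
theorem thetaPairIsRoot_ofThetaSettingData_iff_model :
    FrobenioidThetaBiKummer.ThetaPairIsRoot
        (ofThetaSettingData (pullFrac := fun {_ _} φ x => tf.pullFracModel φ x) μ hC hS h Q R K' constEmb constEmb_injective hinvc hinvp)
        (FrobenioidThetaBiKummer.BiKummerVocabStub.ofBiKummerSetting
          (BiKummerSetting.mkOfConnectedTemperoid (C.temperedArithmeticGroup e) tf hZ hP NH A₀ hA₀ hA₀') (fun {_ _} φ x => tf.pullFracModel φ x) _
          fun _ => (MulEquiv.ofBijective (MonoidHom.id _) Function.bijective_id).symm) ↔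
      (BiKummerSetting.mkOfConnectedTemperoid (C.temperedArithmeticGroup e) tf hZ hP NH A₀ hA₀ hA₀').PairIsNthRootOf
        (fun {_ _} φ x => tf.pullFracModel φ x) ((C.lPNat : ℕ) * N) θ R.pair.num R.pair.den :=
  thetaPairIsRoot_ofConnectedTemperoidData_iff (pullFrac := fun {_ _} φ x => tf.pullFracModel φ x)
    (T := C.thetaEnvData μ hC hS) h Q C.odd_lPNat R (ContinuousMulEquiv.refl _) K' constEmb constEmb_injective hinvc hinvp
    fun A x => tf.pullFracModel_id A x

end Model

/-! ### §3 The LAW-BUILT root family at the Setting: Prop. 5.2 (i) at EVERY level, NO `N`-domain binder -/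

section Family

variable {p : ℕ} [Fact p.Prime] {D : ThetaSetting p} {E : D.EtaleThetaData} {l : ℕ} {C : E.DoubleUnderline l}
  {e : D.toTemperedCurve.GroupLevelData} (hC : D.Compat) (hS : D.Sec2Hyps)
  {D₀ : Type} [Category.{v₀} D₀] {V : FrdIMonoidStub.{0}} {T₀ : RealifiedDivisorMonoids (D₀ := D₀) V}
  {VD : FrdICatStub.{1, 0, 0} (ConnectedPart (BTemp (C.temperedArithmeticGroup e).Pi))}
  {tf : TemperedFrobenioid T₀ (ConnectedPart (BTemp (C.temperedArithmeticGroup e).Pi)) VD} {hZ : tf.monoidType = MonoidType.Z}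
  {hP : ∀ A : (ConnectedPart (BTemp (C.temperedArithmeticGroup e).Pi))ᵒᵖ, IsPerfect (tf.Φ.carrier A)}
  {NH : Subgroup (Field.absoluteGaloisGroup D.K) → tf.category → ℕ+ → Prop} {A₀ : tf.category}
  {hA₀ : PreFrobenioid.IsFrobeniusTrivial tf.toElem A₀} {hA₀' : SemiGraphs.IsGaloisObj A₀.base.obj}
  {θ : tf.biratUnitsModel A₀} {Bl : tf.category}
  {Pl : (BiKummerSetting.mkOfConnectedTemperoid (C.temperedArithmeticGroup e) tf hZ hP NH A₀ hA₀ hA₀').FractionPair θ Bl}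
  (h : ModelFrobenioid.Hypotheses tf.divisorMonoid tf.ratFnFunctor)
  (Rl : (BiKummerSetting.mkOfConnectedTemperoid (C.temperedArithmeticGroup e) tf hZ hP NH A₀ hA₀ hA₀').NthRoot θ Pl C.lPNat
    (fun {_} φ x => tf.pullFracModel φ x))
  (hDSpull : ∀ {A A' : ConnectedPart (BTemp (C.temperedArithmeticGroup e).Pi)} (b : A' ⟶ A) {a b' : tf.Φ.carrier (op A)},
    (∀ x : tf.Φ.carrier (op A), x ∣ a → x ∣ b' → x = 1) →
      ∀ y : tf.Φ.carrier (op A'), y ∣ pull tf.divisorMonoid b a → y ∣ pull tf.divisorMonoid b b' → y = 1)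
  (hEdiv : ∀ (M : ℕ+) (A' : tf.category), PreFrobenioid.IsFrobeniusTrivial tf.toElem A' →
    SemiGraphs.IsGaloisObj A'.base.obj →
      ∃ (A'' : tf.category) (ψ : A'' ⟶ A'), PreFrobenioid.IsPullbackMorphism tf.toElem ψ ∧
        SemiGraphs.IsGaloisObj A''.base.obj ∧ tf.IsMuSaturated A'' M ∧
          ∀ N : ℕ+, (N : ℕ) ∣ (M : ℕ) →
            NH (BiKummerSetting.mkOfConnectedTemperoid (C.temperedArithmeticGroup e) tf hZ hP NH A₀ hA₀ hA₀').HodotBsFld A'' N)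
  (hskl : Nonempty (Rl.AN.base ≅ A₀.base) → Rl.AN = A₀)
  (hfixl : (BiKummerSetting.mkOfConnectedTemperoid (C.temperedArithmeticGroup e) tf hZ hP NH A₀ hA₀ hA₀').IsFixedByHA Rl.AN Rl.αData.isGalois
    Rl.root)
  (Q : FrobenioidTheta.ThetaSubquotientStub.{0} (ConnectedPart (BTemp (C.temperedArithmeticGroup e).Pi)))

include hDSpull hEdiv hskl hfixl in
/-- **[EtTh] Prop. 5.2 (i) at EVERY level of the §5 data OF THE SETTING, for the law-built root family — NO `N`-domain binder.**  From the
[FrdI] Thm. 5.2 hypotheses `h`, the base-level laws `hDSpull` / `hEdiv`, the E2 root law `hR` and ONE `l`-th root datum `Rl` of `Θ̈`'s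
fraction-pair (`hskl`, `hfixl`): a family `R N` (`N ≥ 1`) such that for EVERY level `N`, EVERY mod-`N` cyclotome datum `μ : D.CyclotomeMod l N`
of the Setting, all constants and all divisor invariances, Prop. 5.2 (i) (both alternatives) HOLDS for `ofThetaSettingData μ hC hS h Q (R N) …`
(abc-iut-w6-d053's `exists_rootFamily_thetaPairIsRoot_ofConnectedTemperoid`, p446735, read at `(Π^tp_X̲̲, C.thetaEnvData μ hC hS, id)` level
by level).  [cite: MochizukiEtTh2009, Prop 5.2 (i) p.324 (PDF p.98); Rmk 4.3.2 p.318–319 (PDF pp.92–93); Def 2.13 p.275 (PDF p.49)] -/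
theorem exists_rootFamily_thetaPairIsRoot_ofThetaSetting
    (hR : ∀ (N : ℕ+) (A : ConnectedPart (BTemp (C.temperedArithmeticGroup e).Pi)), SemiGraphs.IsGaloisObj A.obj →
      ∀ f : tf.ratFnFunctor.obj (op A),
        ∃ (A' : ConnectedPart (BTemp (C.temperedArithmeticGroup e).Pi)) (_ : SemiGraphs.IsGaloisObj A'.obj) (b : A' ⟶ A)
          (g : tf.ratFnFunctor.obj (op A')), g ^ (N : ℕ) = pull tf.ratFnFunctor b f) :
    ∃ R : ∀ N : ℕ+, (BiKummerSetting.mkOfConnectedTemperoid (C.temperedArithmeticGroup e) tf hZ hP NH A₀ hA₀ hA₀').NthRoot Rl.root Rl.pair N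
        (fun {_} φ x => tf.pullFracModel φ x),
      ∀ (N : ℕ+) (μ : D.CyclotomeMod l N) (K' : Type) [Field K'] (constEmb : K'ˣ →* tf.biratUnitsModel (R N).BN)
        (constEmb_injective : Function.Injective constEmb)
        (hinvc : ∀ g : Aut (R N).AN.base,
          pull tf.divisorMonoid g.hom (ModelFrobenioid.div (R N).pair.num) = ModelFrobenioid.div (R N).pair.num)
        (hinvp : ∀ y : (C.thetaEnvData μ hC hS).PiX, y ∈ (C.thetaEnvData μ hC hS).PiYdd →
          pull tf.divisorMonoid ((BiKummerSetting.mkOfConnectedTemperoid (C.temperedArithmeticGroup e) tf hZ hP NH A₀ hA₀ hA₀').galoisSurj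
            (R N).AN.base (R N).αData.isGalois ((ContinuousMulEquiv.refl _) y)).hom (ModelFrobenioid.div (R N).pair.den) =
            ModelFrobenioid.div (R N).pair.den),
        FrobenioidThetaBiKummer.ThetaPairIsRoot
          (ofThetaSettingData (pullFrac := fun {_ _} φ x => tf.pullFracModel φ x) μ hC hS h Q (R N) K' constEmb constEmb_injective
            hinvc hinvp)
          (FrobenioidThetaBiKummer.BiKummerVocabStub.ofBiKummerSetting
            (BiKummerSetting.mkOfConnectedTemperoid (C.temperedArithmeticGroup e) tf hZ hP NH A₀ hA₀ hA₀') (fun {_ _} φ x => tf.pullFracModel φ x) _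
            fun _ => (MulEquiv.ofBijective (MonoidHom.id _) Function.bijective_id).symm) :=
  (exists_rootFamily_thetaPairIsRoot_ofConnectedTemperoid h Rl hDSpull hEdiv hskl hfixl Q C.odd_lPNat hR).elim fun R hR' =>
    ⟨R, fun N μ K' _ constEmb constEmb_injective hinvc hinvp =>
      hR' N (C.thetaEnvData μ hC hS) (ContinuousMulEquiv.refl _) K' constEmb constEmb_injective hinvc hinvp⟩

end Family

/-! ### §4 `A_⊙^bs := Ÿ̲̲` (`BiKummerSetting.mkOfThetaSettingYdd`): Prop. 5.2 (i) at the Ÿ̲̲-junction data of the Setting -/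

section OfThetaSettingYddData

variable {p : ℕ} [Fact p.Prime] {D : ThetaSetting p} {E : D.EtaleThetaData} {l : ℕ} {C : E.DoubleUnderline l}
  {e : D.toTemperedCurve.GroupLevelData} {N : ℕ+} (μ : D.CyclotomeMod l N) (hC : D.Compat) (hS : D.Sec2Hyps)
  {D₀ : Type} [Category.{v₀} D₀] {V : FrdIMonoidStub.{0}} {T₀ : RealifiedDivisorMonoids (D₀ := D₀) V}
  {VD : FrdICatStub.{1, 0, 0} (ConnectedPart (BTemp (C.temperedArithmeticGroup e).Pi))}
  {tf : TemperedFrobenioid T₀ (ConnectedPart (BTemp (C.temperedArithmeticGroup e).Pi)) VD} {hZ : tf.monoidType = MonoidType.Z}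
  {hP : ∀ A : (ConnectedPart (BTemp (C.temperedArithmeticGroup e).Pi))ᵒᵖ, IsPerfect (tf.Φ.carrier A)}
  {NH : Subgroup (Field.absoluteGaloisGroup D.K) → tf.category → ℕ+ → Prop}
  {θ : tf.biratUnitsModel (BiKummerSetting.mkOfThetaSettingYdd C e μ hC hS tf hZ hP NH).Aodot} {Bl : tf.category}
  {Pl : (BiKummerSetting.mkOfThetaSettingYdd C e μ hC hS tf hZ hP NH).FractionPair θ Bl}
  {Rl : (BiKummerSetting.mkOfThetaSettingYdd C e μ hC hS tf hZ hP NH).NthRoot θ Pl C.lPNat (fun {_} φ x => tf.pullFracModel φ x)}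
  (h : ModelFrobenioid.Hypotheses tf.divisorMonoid tf.ratFnFunctor)
  (Q : FrobenioidTheta.ThetaSubquotientStub.{0} (ConnectedPart (BTemp (C.temperedArithmeticGroup e).Pi)))
  (R : (BiKummerSetting.mkOfThetaSettingYdd C e μ hC hS tf hZ hP NH).NthRoot Rl.root Rl.pair N (fun {_} φ x => tf.pullFracModel φ x))
  (K' : Type) [Field K'] (constEmb : K'ˣ →* tf.biratUnitsModel R.BN) (constEmb_injective : Function.Injective constEmb)
  (hinvc : ∀ g : Aut R.AN.base,
    pull tf.divisorMonoid g.hom (ModelFrobenioid.div R.pair.num) = ModelFrobenioid.div R.pair.num)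
  (hinvp : ∀ y : (C.thetaEnvData μ hC hS).PiX, y ∈ (C.thetaEnvData μ hC hS).PiYdd →
    pull tf.divisorMonoid ((BiKummerSetting.mkOfThetaSettingYdd C e μ hC hS tf hZ hP NH).galoisSurj
      R.AN.base R.αData.isGalois ((ContinuousMulEquiv.refl _) y)).hom (ModelFrobenioid.div R.pair.den) = ModelFrobenioid.div R.pair.den)

/-- **[EtTh] Prop. 5.2 (i) — BOTH alternatives — at the §5 data of the Setting with `A_⊙^bs := Ÿ̲̲`** («the object defined by the trivial line
bundle over `Ÿ̲̲^log`», p.322; the Ÿ̲̲-junction data of record) and the model pull-back, modulo EXACTLY {`hsk`, `hμ`, `hcondA`} on the `N`-domain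
`A_N` (abc-iut-L2-t4's `…_of_comp` ∘ abc-iut-w5-d134's composite root).  [cite: MochizukiEtTh2009, Prop 5.2 (i) p.324 (PDF p.98); §5 p.322 (PDF p.96)] -/
theorem thetaPairIsRoot_ofThetaSettingYddData_of_comp
    (hsk : Nonempty (R.AN.base ≅ (BiKummerSetting.mkOfThetaSettingYdd C e μ hC hS tf hZ hP NH).Aodot.base) →
      R.AN = (BiKummerSetting.mkOfThetaSettingYdd C e μ hC hS tf hZ hP NH).Aodot)
    (hμ : tf.IsMuSaturated R.AN (C.lPNat * N))
    (hcondA : ∃ (A' A'' : tf.category) (s₁ : A' ⟶ R.AN) (s₂ : A' ⟶ A''),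
      (BiKummerSetting.mkOfThetaSettingYdd C e μ hC hS tf hZ hP NH).IsPreStep s₁ ∧
        (BiKummerSetting.mkOfThetaSettingYdd C e μ hC hS tf hZ hP NH).IsPreStep s₂ ∧
          (BiKummerSetting.mkOfThetaSettingYdd C e μ hC hS tf hZ hP NH).IsFrobeniusTrivial A'' ∧
            (BiKummerSetting.mkOfThetaSettingYdd C e μ hC hS tf hZ hP NH).IsNHSaturatedBsFld
              (BiKummerSetting.mkOfThetaSettingYdd C e μ hC hS tf hZ hP NH).HodotBsFld A'' (C.lPNat * N)) :
    FrobenioidThetaBiKummer.ThetaPairIsRoot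
      (ofThetaSettingData (pullFrac := fun {_ _} φ x => tf.pullFracModel φ x) μ hC hS h Q R K' constEmb constEmb_injective hinvc hinvp)
      (FrobenioidThetaBiKummer.BiKummerVocabStub.ofBiKummerSetting
        (BiKummerSetting.mkOfThetaSettingYdd C e μ hC hS tf hZ hP NH) (fun {_ _} φ x => tf.pullFracModel φ x) _
        fun _ => (MulEquiv.ofBijective (MonoidHom.id _) Function.bijective_id).symm) :=
  thetaPairIsRoot_ofConnectedTemperoidData_of_comp (T := C.thetaEnvData μ hC hS) h Q C.odd_lPNat R (ContinuousMulEquiv.refl _) K'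
    constEmb constEmb_injective hinvc hinvp hsk hμ hcondA

/-- **SECOND alternative at the Ÿ̲̲-junction data of the Setting (model pull-back) — UNCONDITIONAL.** [cite: MochizukiEtTh2009, Prop 5.2 (i) p.324 (PDF p.98)] -/
theorem thetaPairIsRoot_second_ofThetaSettingYddData_model :
    ∃ (A' : (BiKummerSetting.mkOfThetaSettingYdd C e μ hC hS tf hZ hP NH).C)
      (g : (ofThetaSettingData (pullFrac := fun {_ _} φ x => tf.pullFracModel φ x) μ hC hS h Q R K' constEmb constEmb_injective hinvc
        hinvp).biratUnits A'),
      (FrobenioidThetaBiKummer.BiKummerVocabStub.ofBiKummerSetting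
          (BiKummerSetting.mkOfThetaSettingYdd C e μ hC hS tf hZ hP NH) (fun {_ _} φ x => tf.pullFracModel φ x)
          (ofThetaSettingData (pullFrac := fun {_ _} φ x => tf.pullFracModel φ x) μ hC hS h Q R K' constEmb constEmb_injective hinvc hinvp)
          fun _ => (MulEquiv.ofBijective (MonoidHom.id _) Function.bijective_id).symm).IsRootOf
        (ofThetaSettingData (pullFrac := fun {_ _} φ x => tf.pullFracModel φ x) μ hC hS h Q R K' constEmb constEmb_injective hinvc hinvp).l g
        (ofThetaSettingData (pullFrac := fun {_ _} φ x => tf.pullFracModel φ x) μ hC hS h Q R K' constEmb constEmb_injective hinvc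
          hinvp).thetaFn ∧
      (FrobenioidThetaBiKummer.BiKummerVocabStub.ofBiKummerSetting
          (BiKummerSetting.mkOfThetaSettingYdd C e μ hC hS tf hZ hP NH) (fun {_ _} φ x => tf.pullFracModel φ x)
          (ofThetaSettingData (pullFrac := fun {_ _} φ x => tf.pullFracModel φ x) μ hC hS h Q R K' constEmb constEmb_injective hinvc hinvp)
          fun _ => (MulEquiv.ofBijective (MonoidHom.id _) Function.bijective_id).symm).IsRootOfRightFractionPair
        (ofThetaSettingData (pullFrac := fun {_ _} φ x => tf.pullFracModel φ x) μ hC hS h Q R K' constEmb constEmb_injective hinvc hinvp).N g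
        (ofThetaSettingData (pullFrac := fun {_ _} φ x => tf.pullFracModel φ x) μ hC hS h Q R K' constEmb constEmb_injective hinvc hinvp).sCap
        (ofThetaSettingData (pullFrac := fun {_ _} φ x => tf.pullFracModel φ x) μ hC hS h Q R K' constEmb constEmb_injective hinvc
          hinvp).sCup :=
  thetaPairIsRoot_second_ofConnectedTemperoidData (pullFrac := fun {_ _} φ x => tf.pullFracModel φ x)
    (T := C.thetaEnvData μ hC hS) h Q C.odd_lPNat R (ContinuousMulEquiv.refl _) K' constEmb constEmb_injective hinvc hinvp
    fun A x => tf.pullFracModel_id A x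

/-- **Residual isolation at the Ÿ̲̲-junction data of the Setting (model pull-back)**: the typed Prop. 5.2 (i) ⟺ its first alternative; with
`thetaPairIsRoot_ofThetaSettingYddData_of_comp` the node's open content there is exactly {`hsk`, `hμ`, `hcondA`}. [cite: MochizukiEtTh2009, Prop 5.2 (i) p.324 (PDF p.98)] -/
theorem thetaPairIsRoot_ofThetaSettingYddData_iff_model :
    FrobenioidThetaBiKummer.ThetaPairIsRoot
        (ofThetaSettingData (pullFrac := fun {_ _} φ x => tf.pullFracModel φ x) μ hC hS h Q R K' constEmb constEmb_injective hinvc hinvp)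
        (FrobenioidThetaBiKummer.BiKummerVocabStub.ofBiKummerSetting
          (BiKummerSetting.mkOfThetaSettingYdd C e μ hC hS tf hZ hP NH) (fun {_ _} φ x => tf.pullFracModel φ x) _
          fun _ => (MulEquiv.ofBijective (MonoidHom.id _) Function.bijective_id).symm) ↔
      (BiKummerSetting.mkOfThetaSettingYdd C e μ hC hS tf hZ hP NH).PairIsNthRootOf
        (fun {_ _} φ x => tf.pullFracModel φ x) ((C.lPNat : ℕ) * N) θ R.pair.num R.pair.den :=
  thetaPairIsRoot_ofConnectedTemperoidData_iff (pullFrac := fun {_ _} φ x => tf.pullFracModel φ x)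
    (T := C.thetaEnvData μ hC hS) h Q C.odd_lPNat R (ContinuousMulEquiv.refl _) K' constEmb constEmb_injective hinvc hinvp
    fun A x => tf.pullFracModel_id A x

end OfThetaSettingYddData

end ThetaFrobenioid

end Literature.AnabelianGeometry.EtaleTheta

end
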